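import Mathlib

/-!
# The odd cyclotomic cofactor and powers of two (solo-blind seat, session 7; part 1 of 2)

Lifting-the-exponent at the prime `2`, in the elementary form "for odd `X, Y` and an odd number `g` of terms the
cofactor `∑ X^i (±Y)^(g-1-i)` of `X ∓ Y` in `X^g ∓ Y^g` is odd" (Mathlib's `not_dvd_geom_sum₂` at the prime `2`
of `ℤ`), and its consequences for the equations `X^g ± Y^g = 2ⁿ`:

* `odd_geom_sum₂` : the cofactor is odd;
* `odd_pow_sub_pow_eq_two_pow`, `odd_pow_add_pow_eq_two_pow` : `X, Y` odd, `1 < X`, `g` odd, `X^g ∓ Y^g = 2ⁿ` ⇒ `g = 1`;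
* `odd_pow_add_pow_ne_two_pow` : `X, Y` odd, `1 < X`, `g` even, `g ≠ 0` ⇒ `X^g + Y^g ≠ 2ⁿ` (squares are `1 mod 4`);
* `two_pow_sub_one_ne_pow` : `2^a - 1` (`a ≥ 1`) is not a perfect power `y^e`, `y > 1`, `e ≥ 2`;
* `two_pow_add_one_eq_pow` : `2^a + 1 = x^e` with `e ≥ 2` forces `(a, x, e) = (3, 3, 2)`.

Part 2 (`SoloBlindCoprimeExponents`) applies these to the generic `ω = 3` equations `2^l + q^m = rⁿ` and
`p^l + q^m = 2ⁿ`. All proofs are elementary (Mathlib only). [folklore]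
-/

namespace Summit.ABC.ABC.Theorems

open Finset

/-! ### The parity of the cyclotomic cofactor -/

/-- For odd integers `x, y` and an odd number `g` of terms, `∑_{i<g} x^i y^(g-1-i)` is odd. -/
theorem odd_geom_sum₂ {x y : ℤ} (hx : Odd x) (hy : Odd y) {g : ℕ} (hg : Odd g) :
    Odd (∑ i ∈ range g, x ^ i * y ^ (g - 1 - i)) := by
  have hxy : (2 : ℤ) ∣ x - y := by
    obtain ⟨a, rfl⟩ := hx
    obtain ⟨b, rfl⟩ := hy
    exact ⟨a - b, by ring⟩
  have hx2 : ¬ (2 : ℤ) ∣ x := by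
    rw [← even_iff_two_dvd, ← Int.not_odd_iff_even, not_not]; exact hx
  have hg2 : ¬ (2 : ℤ) ∣ (g : ℤ) := by
    intro h
    have : (2 : ℕ) ∣ g := by exact_mod_cast h
    exact (Nat.not_even_iff_odd.mpr hg) (even_iff_two_dvd.mpr this)
  have h := not_dvd_geom_sum₂ Int.prime_two hxy hx2 hg2
  rwa [← even_iff_two_dvd, Int.not_even_iff_odd] at h

/-- An odd integer dividing a power of two is `±1`. -/
theorem natAbs_eq_one_of_odd_of_dvd_two_pow {s : ℤ} (hs : Odd s) {n : ℕ} (h : s ∣ (2 : ℤ) ^ n) :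
    s.natAbs = 1 := by
  have h1 : s.natAbs ∣ 2 ^ n := by
    have := Int.natAbs_dvd_natAbs.mpr h
    simpa [Int.natAbs_pow] using this
  obtain ⟨k, -, hk⟩ := (Nat.dvd_prime_pow Nat.prime_two).mp h1
  have hodd : Odd s.natAbs := Int.natAbs_odd.mpr hs
  rcases k with _ | k
  · simpa using hk
  · exfalso
    rw [hk] at hodd
    exact (Nat.not_even_iff_odd.mpr hodd) ⟨2 ^ k, by ring⟩

/-! ### Odd bases, odd exponent -/

/-- **Difference.** `X > Y` odd naturals, `g` odd, `X^g - Y^g = 2^l` ⇒ `g = 1`. -/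
theorem odd_pow_sub_pow_eq_two_pow {X Y g l : ℕ} (hX : Odd X) (hY : Odd Y) (hYX : Y < X) (hg : Odd g)
    (h : X ^ g - Y ^ g = 2 ^ l) : g = 1 := by
  have hY1 : 1 ≤ Y := by obtain ⟨u, rfl⟩ := hY; omega
  have hpow : Y ^ g ≤ X ^ g := Nat.pow_le_pow_left hYX.le g
  -- pass to ℤ
  set S : ℤ := ∑ i ∈ range g, (X : ℤ) ^ i * (Y : ℤ) ^ (g - 1 - i) with hS
  have hSodd : Odd S := odd_geom_sum₂ (by exact_mod_cast hX) (by exact_mod_cast hY) hg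
  have hkey : S * ((X : ℤ) - Y) = (2 : ℤ) ^ l := by
    rw [hS, geom_sum₂_mul]
    have : ((X ^ g - Y ^ g : ℕ) : ℤ) = (2 : ℤ) ^ l := by exact_mod_cast h
    rw [Nat.cast_sub hpow] at this
    push_cast at this
    exact this
  have hSdvd : S ∣ (2 : ℤ) ^ l := ⟨(X : ℤ) - Y, by rw [← hkey]⟩
  have hS1 : S.natAbs = 1 := natAbs_eq_one_of_odd_of_dvd_two_pow hSodd hSdvd
  -- but `S ≥ g` since each of the `g` terms is `≥ 1`
  have hSge : (g : ℤ) ≤ S := by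
    rw [hS]
    have : ∀ i ∈ range g, (1 : ℤ) ≤ (X : ℤ) ^ i * (Y : ℤ) ^ (g - 1 - i) := by
      intro i _
      have h1 : (1 : ℤ) ≤ (X : ℤ) ^ i := one_le_pow₀ (by exact_mod_cast (by omega : 1 ≤ X))
      have h2 : (1 : ℤ) ≤ (Y : ℤ) ^ (g - 1 - i) := one_le_pow₀ (by exact_mod_cast hY1)
      nlinarith
    calc (g : ℤ) = ∑ i ∈ range g, (1 : ℤ) := by simp
      _ ≤ ∑ i ∈ range g, (X : ℤ) ^ i * (Y : ℤ) ^ (g - 1 - i) := Finset.sum_le_sum this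
  have hSle : S ≤ 1 := by
    have := Int.natAbs_eq_iff.mp hS1
    rcases this with h1 | h1 <;> simp [h1]
  have hg1 : g ≤ 1 := by exact_mod_cast hSge.trans hSle
  obtain ⟨u, rfl⟩ := hg
  omega

/-- **Sum.** `X, Y` odd naturals with `1 < X`, `g` odd, `X^g + Y^g = 2ⁿ` ⇒ `g = 1`. -/
theorem odd_pow_add_pow_eq_two_pow {X Y g n : ℕ} (hX : Odd X) (hY : Odd Y) (hX1 : 1 < X) (hg : Odd g)
    (h : X ^ g + Y ^ g = 2 ^ n) : g = 1 := by
  have hY1 : 1 ≤ Y := by obtain ⟨u, rfl⟩ := hY; omega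
  set S : ℤ := ∑ i ∈ range g, (X : ℤ) ^ i * (-(Y : ℤ)) ^ (g - 1 - i) with hS
  have hSodd : Odd S :=
    odd_geom_sum₂ (by exact_mod_cast hX) ((by exact_mod_cast hY : Odd (Y : ℤ)).neg) hg
  have hkey : S * ((X : ℤ) + Y) = (2 : ℤ) ^ n := by
    have e : (X : ℤ) + Y = X - (-(Y : ℤ)) := by ring
    rw [hS, e, geom_sum₂_mul, Odd.neg_pow hg]
    have : ((X ^ g + Y ^ g : ℕ) : ℤ) = (2 : ℤ) ^ n := by exact_mod_cast h
    push_cast at this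
    linarith
  have hSdvd : S ∣ (2 : ℤ) ^ n := ⟨(X : ℤ) + Y, by rw [← hkey]⟩
  have hS1 : S.natAbs = 1 := natAbs_eq_one_of_odd_of_dvd_two_pow hSodd hSdvd
  -- `S = ±1`, so `X^g + Y^g = ±(X + Y)`, hence `X^g + Y^g ≤ X + Y`
  have hle : (X : ℤ) ^ g + (Y : ℤ) ^ g ≤ (X : ℤ) + Y := by
    have hsum : ((X : ℤ) ^ g + (Y : ℤ) ^ g) = S * ((X : ℤ) + Y) := by
      rw [hkey]; exact_mod_cast h
    have hpos : (0 : ℤ) ≤ (X : ℤ) + Y := by positivity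
    rcases Int.natAbs_eq_iff.mp hS1 with h1 | h1
    · simp only [Nat.cast_one] at h1
      rw [hsum, h1]; simp
    · simp only [Nat.cast_one] at h1
      rw [hsum, h1]; linarith
  -- but for `g ≥ 3` (odd, `≠ 1`) and `X ≥ 2` this fails
  by_contra hg1
  have hg3 : 3 ≤ g := by obtain ⟨u, rfl⟩ := hg; omega
  have hXg : (X : ℤ) + X ≤ (X : ℤ) ^ g := by
    have hX2 : (2 : ℤ) ≤ X := by exact_mod_cast hX1
    calc (X : ℤ) + X = X * 2 := by ring
      _ ≤ (X : ℤ) * (X : ℤ) ^ (g - 1) := by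
          apply mul_le_mul_of_nonneg_left _ (by positivity)
          calc (2 : ℤ) ≤ X := hX2
            _ = (X : ℤ) ^ 1 := (pow_one _).symm
            _ ≤ (X : ℤ) ^ (g - 1) := pow_le_pow_right₀ (by linarith) (by omega)
      _ = (X : ℤ) ^ g := by rw [← pow_succ']; congr 1; omega
  have hYg : (Y : ℤ) ≤ (Y : ℤ) ^ g := by
    calc (Y : ℤ) = (Y : ℤ) ^ 1 := (pow_one _).symm
      _ ≤ (Y : ℤ) ^ g := pow_le_pow_right₀ (by exact_mod_cast hY1) (by omega)
  have hX0 : (0 : ℤ) < X := by exact_mod_cast (by omega : 0 < X)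
  linarith

/-! ### Odd bases, even exponent -/

/-- `X, Y` odd, `1 < X`, `g` even and nonzero: `X^g + Y^g` is never a power of two (it is `2 mod 4` and `> 2`). -/
theorem odd_pow_add_pow_ne_two_pow {X Y g n : ℕ} (hX : Odd X) (hY : Odd Y) (hX1 : 1 < X) (hg : Even g)
    (hg0 : g ≠ 0) (h : X ^ g + Y ^ g = 2 ^ n) : False := by
  obtain ⟨k, rfl⟩ := hg
  have hk : k ≠ 0 := by omega
  have hY1 : 1 ≤ Y := by obtain ⟨u, rfl⟩ := hY; omega
  -- squares of odd numbers are `1 mod 4`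
  have hX4 : X ^ (k + k) % 4 = 1 := by
    obtain ⟨u, hu⟩ := hX.pow (n := k)
    have : X ^ (k + k) = 4 * (u * u + u) + 1 := by rw [pow_add, hu]; ring
    omega
  have hY4 : Y ^ (k + k) % 4 = 1 := by
    obtain ⟨u, hu⟩ := hY.pow (n := k)
    have : Y ^ (k + k) = 4 * (u * u + u) + 1 := by rw [pow_add, hu]; ring
    omega
  have hmod : 2 ^ n % 4 = 2 := by rw [← h]; omega
  -- hence `n = 1`
  have hn : n = 1 := by
    rcases n with _ | _ | n
    · norm_num at hmod
    · rfl
    · exfalso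
      have : 4 ∣ 2 ^ (n + 2) := ⟨2 ^ n, by ring⟩
      omega
  subst hn
  have hXbig : 4 ≤ X ^ (k + k) := by
    calc 4 = 2 ^ 2 := by norm_num
      _ ≤ X ^ 2 := Nat.pow_le_pow_left (by omega) 2
      _ ≤ X ^ (k + k) := Nat.pow_le_pow_right (by omega) (by omega)
  have hYbig : 1 ≤ Y ^ (k + k) := Nat.one_le_pow _ _ hY1
  omega

/-! ### Perfect powers next to a power of two -/

/-- `2^a - 1` (`a ≥ 1`) is never a perfect power `y^e` with `e ≥ 2` and `y > 1`. -/
theorem two_pow_sub_one_ne_pow {a y e : ℕ} (ha : 1 ≤ a) (hy : 1 < y) (he : 2 ≤ e)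
    (h : 2 ^ a - 1 = y ^ e) : False := by
  have h2a : 1 ≤ 2 ^ a := Nat.one_le_two_pow
  have hyodd : Odd y := by
    by_contra hev
    rw [Nat.not_odd_iff_even] at hev
    have : Even (y ^ e) := hev.pow_of_ne_zero (by omega)
    have : Even (2 ^ a - 1) := h ▸ this
    obtain ⟨u, hu⟩ := this
    have : (2 : ℕ) ^ a % 2 = 0 := by
      rcases a with _ | a
      · omega
      · simp [pow_succ]
    omega
  have h' : y ^ e + 1 ^ e = 2 ^ a := by rw [one_pow]; omega
  rcases Nat.even_or_odd e with hev | hod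
  · exact odd_pow_add_pow_ne_two_pow hyodd odd_one hy hev (by omega) h'
  · have := odd_pow_add_pow_eq_two_pow hyodd odd_one hy hod h'
    omega

/-- `2^a + 1 = x^e` with `e ≥ 2` forces `(a, x, e) = (3, 3, 2)` (`8 + 1 = 9`). -/
theorem two_pow_add_one_eq_pow {a x e : ℕ} (he : 2 ≤ e) (h : 2 ^ a + 1 = x ^ e) :
    a = 3 ∧ x = 3 ∧ e = 2 := by
  have h2a : 1 ≤ 2 ^ a := Nat.one_le_two_pow
  have hx1 : 1 < x := by
    by_contra hx
    interval_cases x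
    · rw [zero_pow (by omega)] at h; omega
    · rw [one_pow] at h; omega
  have ha : 1 ≤ a := by
    by_contra ha0
    have : a = 0 := by omega
    subst this
    -- `2 = x^e` with `e ≥ 2`, `x ≥ 2`: impossible
    have : 4 ≤ x ^ e := by
      calc 4 = 2 ^ 2 := by norm_num
        _ ≤ x ^ 2 := Nat.pow_le_pow_left (by omega) 2
        _ ≤ x ^ e := Nat.pow_le_pow_right (by omega) he
    norm_num at h; omega
  have hxodd : Odd x := by
    by_contra hev
    rw [Nat.not_odd_iff_even] at hev
    have : Even (x ^ e) := hev.pow_of_ne_zero (by omega)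
    rw [← h] at this
    obtain ⟨u, hu⟩ := this
    have : (2 : ℕ) ^ a % 2 = 0 := by
      rcases a with _ | a
      · omega
      · simp [pow_succ]
    omega
  rcases Nat.even_or_odd e with hev | hod
  · -- `x^(2k) - 1 = 2^a`: `(x^k - 1)(x^k + 1) = 2^a`, two powers of two differing by `2`
    obtain ⟨k, rfl⟩ := hev
    have hk : 1 ≤ k := by omega
    set Z := x ^ k with hZ
    have hZodd : Odd Z := hZ ▸ hxodd.pow
    have hZ1 : 1 < Z := by
      rw [hZ]
      calc 1 < x := hx1
        _ = x ^ 1 := (pow_one x).symm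
        _ ≤ x ^ k := Nat.pow_le_pow_right (by omega) hk
    have hZZ : x ^ (k + k) = Z * Z := by rw [hZ, ← pow_add]
    obtain ⟨A, hA⟩ : ∃ A, Z = A + 1 := ⟨Z - 1, by omega⟩
    have hprod : A * (A + 2) = 2 ^ a := by
      have : Z * Z = A * (A + 2) + 1 := by rw [hA]; ring
      omega
    have hdm : A ∣ 2 ^ a := ⟨A + 2, hprod.symm⟩
    have hdp : A + 2 ∣ 2 ^ a := ⟨A, by rw [mul_comm]; exact hprod.symm⟩
    obtain ⟨i, -, hi⟩ := (Nat.dvd_prime_pow Nat.prime_two).mp hdm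
    obtain ⟨j, -, hj⟩ := (Nat.dvd_prime_pow Nat.prime_two).mp hdp
    have hij : 2 ^ j = 2 ^ i + 2 := by omega
    -- `i = 1`: `i = 0` would make `Z = 2` even; `i ≥ 2` contradicts `2^j ≡ 2 mod 4`
    have hA2 : A = 2 := by
      rcases i with _ | _ | i
      · exfalso
        have : Z = 2 := by simp at hi; omega
        rw [this] at hZodd; exact (Nat.not_even_iff_odd.mpr hZodd) (by decide)
      · simpa using hi
      · exfalso
        have h4 : 4 ∣ 2 ^ (i + 2) := ⟨2 ^ i, by ring⟩
        have hpos : 0 < 2 ^ (i + 2) := pow_pos (by norm_num) _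
        rcases j with _ | _ | j
        · rw [pow_zero] at hij; omega
        · rw [zero_add, pow_one] at hij; omega
        · have : 4 ∣ 2 ^ (j + 2) := ⟨2 ^ j, by ring⟩
          omega
    have hZ3 : Z = 3 := by omega
    -- `x^k = 3` ⇒ `k = 1` (else `x^k ≥ 9`), `x = 3`
    have hx3 : 3 ≤ x := by obtain ⟨w, hw⟩ := hxodd; omega
    have hk1 : k = 1 := by
      by_contra hk1
      have : 9 ≤ x ^ k := by
        calc 9 = 3 ^ 2 := by norm_num
          _ ≤ x ^ 2 := Nat.pow_le_pow_left hx3 2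
          _ ≤ x ^ k := Nat.pow_le_pow_right (by omega) (by omega)
      omega
    subst hk1
    have hx3 : x = 3 := by simpa [hZ] using hZ3
    subst hx3
    refine ⟨?_, rfl, rfl⟩
    have h8 : 2 ^ a = 2 ^ 3 := by
      have : A * (A + 2) = 8 := by rw [hA2]
      omega
    exact Nat.pow_right_injective (le_refl 2) h8
  · -- odd `e ≥ 3`: `x^e - 1^e = 2^a` forces `e = 1`
    have h' : x ^ e - 1 ^ e = 2 ^ a := by rw [one_pow]; omega
    have := odd_pow_sub_pow_eq_two_pow hxodd odd_one hx1 hod h'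
    omega

end Summit.ABC.ABC.Theorems
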